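import Literature.Geometry.Kaehler.RiemannianHodgeSmoothProofs
import Mathlib.LinearAlgebra.Multilinear.FiniteDimensional
import Mathlib.Analysis.Calculus.ContDiff.FiniteDimension
import HarnessLib

/-!
# The metric and the Gram–Schmidt frame read in a chart are smooth on the whole chart target

`Literature.Geometry.Kaehler.RiemannianHodgeSmoothProofs` proves that the metric coefficients
`trivMetric I x₀ (φ⁻¹ y)`, the Gram–Schmidt frame `gsFrameModel`/`onFrameModel` read in the
trivialization at `x₀`, and hence the chart formula for the Hodge star, are `C^∞` within `range I`
*at the chart point of `x₀`* — which is all that the chart-centre definition of `IsSmoothForm`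
needs. The reduction of the elliptic theory of the Laplacians to the torus (F. W. Warner, GTM 94
(1983), 6.31–6.33) reads a neighbourhood of `x₀` in one fixed chart and needs these coordinate
expressions to be `C^∞` on (a neighbourhood in) the chart *target*. This file proves the global
versions:

* `contDiffOn_trivMetric` — `y ↦ trivMetric I x₀ (φ⁻¹ y)` is `C^∞` on `(extChartAt I x₀).target`
  (the `C^∞` section `g` read in the trivialization at `x₀` is `C^∞` on the whole base set,
  Mathlib's `Trivialization.contMDiffOn_section_baseSet_iff`);
* `contDiffOn_gsFrameModel`, `contDiffOn_onFrameModel` — the (orthonormal) Gram–Schmidt frame read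
  in the trivialization is `C^∞` on the target (the recursion `gsFrameModel_eq` holds on the whole
  chart domain).

## References

* F. W. Warner, *Foundations of Differentiable Manifolds and Lie Groups*, GTM 94 (1983), 4.10,
  p. 149; 6.32. [WarnerGTM94]
* J. M. Lee, *Introduction to Smooth Manifolds*, 2nd ed. (2013), Prop. 13.6.
-/

noncomputable section

open scoped Manifold ContDiff Topology
open Bundle Module Set Filter InnerProductSpace

namespace Literature.Geometry.Kaehler

section Frame

variable {E : Type*} [NormedAddCommGroup E] [NormedSpace ℝ E]
  {H : Type*} [TopologicalSpace H] (I : ModelWithCorners ℝ E H)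
  {M : Type*} [TopologicalSpace M] [ChartedSpace H M] [IsManifold I ∞ M]
  [RiemannianBundle (fun x : M ↦ TangentSpace I x)]

set_option synthInstance.maxHeartbeats 400000 in
/-- **The metric coefficients of a smooth metric are smooth on the whole chart target.** For a
`C^∞` Riemannian metric, `y ↦ trivMetric I x₀ (φ⁻¹ y)` is `C^∞` on `(extChartAt I x₀).target`:
the `C^∞` section `g` of the bundle of bilinear forms read in the trivialization at `x₀` is `C^∞`
on the base set of that trivialization (`Trivialization.contMDiffOn_section_baseSet_iff`), and
the base set is the chart domain. Warner (1983), 2.1 / 4.10. [cite: WarnerGTM94, 4.10, p. 149] -/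
theorem contDiffOn_trivMetric
    [IsContMDiffRiemannianBundle I ∞ E (fun x : M ↦ TangentSpace I x)] (x₀ : M) :
    ContDiffOn ℝ ∞ (fun y ↦ trivMetric I x₀ ((extChartAt I x₀).symm y)) (extChartAt I x₀).target := by
  obtain ⟨g, g_smooth, hg⟩ :=
    (‹IsContMDiffRiemannianBundle I ∞ E (fun x : M ↦ TangentSpace I x)›).exists_contMDiff
  set e := trivializationAt (E →L[ℝ] E →L[ℝ] ℝ)
    (fun x : M ↦ TangentSpace I x →L[ℝ] TangentSpace I x →L[ℝ] ℝ) x₀ with he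
  -- the section read in the trivialization at `x₀` is `C^∞` on the base set (= chart domain)
  have h1 : ContMDiffOn I 𝓘(ℝ, E →L[ℝ] E →L[ℝ] ℝ) ∞ (fun x ↦ (e ⟨x, g x⟩).2) e.baseSet :=
    (e.contMDiffOn_section_baseSet_iff).1 (g_smooth.contMDiffOn)
  have hbase : e.baseSet = (chartAt H x₀).source := by
    rw [he, hom_trivializationAt_baseSet, hom_trivializationAt_baseSet, TangentBundle.trivializationAt_baseSet]
    simp
  have hmaps : (extChartAt I x₀).target ⊆ (extChartAt I x₀).symm ⁻¹' e.baseSet := fun y hy ↦ by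
    rw [mem_preimage, hbase, ← extChartAt_source I]
    exact (extChartAt I x₀).map_target hy
  have h2 : ContMDiffOn 𝓘(ℝ, E) 𝓘(ℝ, E →L[ℝ] E →L[ℝ] ℝ) ∞
      ((fun x ↦ (e ⟨x, g x⟩).2) ∘ (extChartAt I x₀).symm) (extChartAt I x₀).target :=
    h1.comp (contMDiffOn_extChartAt_symm x₀) hmaps
  refine (contMDiffOn_iff_contDiffOn.1 h2).congr fun y _ ↦ ?_
  ext v w
  simp only [Function.comp_apply, trivMetric_apply]
  rw [he, trivializationAt_bilinForm_apply₂, ← hg]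

variable [FiniteDimensional ℝ E] {n : ℕ} [Fact (finrank ℝ E = n)]

open Literature.NumberTheory.Transcendental (modelBasis)

/-- **The Gram–Schmidt frame read in the trivialization is `C^∞` on the whole chart target**
(strong induction on `j` through the recursion `gsFrameModel_eq`, valid on the whole chart domain,
with the metric coefficients `C^∞` on the target and the denominators `G(c_i, c_i) > 0` there).
Warner (1983), 4.10, p. 149; Lee (2013), Prop. 13.6. [cite: WarnerGTM94, 4.10, p. 149] -/
theorem contDiffOn_gsFrameModel
    [IsContMDiffRiemannianBundle I ∞ E (fun x : M ↦ TangentSpace I x)] (x₀ : M) (j : Fin n) :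
    ContDiffOn ℝ ∞ (fun y ↦ gsFrameModel I x₀ ((extChartAt I x₀).symm y) j) (extChartAt I x₀).target := by
  induction j using WellFoundedLT.induction with | ind j ih
  have hG := contDiffOn_trivMetric I x₀
  have hsrc : ∀ y ∈ (extChartAt I x₀).target,
      (extChartAt I x₀).symm y ∈ (chartAt H x₀).source := fun y hy ↦ by
    rw [← extChartAt_source I]
    exact (extChartAt I x₀).map_target hy
  -- the recursion, on the chart target
  have key : ∀ y ∈ (extChartAt I x₀).target,
      gsFrameModel I x₀ ((extChartAt I x₀).symm y) j =
        modelBasis E n j - ∑ i ∈ Finset.Iio j,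
          (trivMetric I x₀ ((extChartAt I x₀).symm y)
              (gsFrameModel I x₀ ((extChartAt I x₀).symm y) i) (modelBasis E n j) /
            trivMetric I x₀ ((extChartAt I x₀).symm y)
              (gsFrameModel I x₀ ((extChartAt I x₀).symm y) i)
              (gsFrameModel I x₀ ((extChartAt I x₀).symm y) i)) •
          gsFrameModel I x₀ ((extChartAt I x₀).symm y) i :=
    fun y hy ↦ gsFrameModel_eq I (hsrc y hy) j
  -- the right-hand side of the recursion is smooth on the target
  have hsm : ContDiffOn ℝ ∞ (fun y ↦
        modelBasis E n j - ∑ i ∈ Finset.Iio j,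
          (trivMetric I x₀ ((extChartAt I x₀).symm y)
              (gsFrameModel I x₀ ((extChartAt I x₀).symm y) i) (modelBasis E n j) /
            trivMetric I x₀ ((extChartAt I x₀).symm y)
              (gsFrameModel I x₀ ((extChartAt I x₀).symm y) i)
              (gsFrameModel I x₀ ((extChartAt I x₀).symm y) i)) •
          gsFrameModel I x₀ ((extChartAt I x₀).symm y) i) (extChartAt I x₀).target := by
    refine contDiffOn_const.sub (ContDiffOn.sum fun i hi ↦ ?_)
    have hi' : i < j := Finset.mem_Iio.1 hi
    have hne : ∀ y ∈ (extChartAt I x₀).target, trivMetric I x₀ ((extChartAt I x₀).symm y)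
        (gsFrameModel I x₀ ((extChartAt I x₀).symm y) i)
        (gsFrameModel I x₀ ((extChartAt I x₀).symm y) i) ≠ 0 := fun y hy ↦
      (trivMetric_gsFrameModel_self_pos I (hsrc y hy) i).ne'
    exact ((((hG.clm_apply (ih i hi')).clm_apply contDiffOn_const).div
      ((hG.clm_apply (ih i hi')).clm_apply (ih i hi')) hne).smul (ih i hi'))
  exact hsm.congr key

/-- **The orthonormal frame read in the trivialization is `C^∞` on the whole chart target**
(`onFrameModel_eq`: `e_j = G(c_j, c_j)^{-1/2} c_j` on the chart domain, `t ↦ t^{-1/2}` smooth on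
`(0, ∞)`). Warner (1983), 4.10, p. 149; Lee (2013), Prop. 13.6. [cite: WarnerGTM94, 4.10, p. 149] -/
theorem contDiffOn_onFrameModel
    [IsContMDiffRiemannianBundle I ∞ E (fun x : M ↦ TangentSpace I x)] (x₀ : M) (j : Fin n) :
    ContDiffOn ℝ ∞ (fun y ↦ onFrameModel I x₀ ((extChartAt I x₀).symm y) j) (extChartAt I x₀).target := by
  have hG := contDiffOn_trivMetric I x₀
  have hgs := contDiffOn_gsFrameModel I x₀ j
  have hsrc : ∀ y ∈ (extChartAt I x₀).target,
      (extChartAt I x₀).symm y ∈ (chartAt H x₀).source := fun y hy ↦ by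
    rw [← extChartAt_source I]
    exact (extChartAt I x₀).map_target hy
  have key : ∀ y ∈ (extChartAt I x₀).target,
      onFrameModel I x₀ ((extChartAt I x₀).symm y) j =
        (√(trivMetric I x₀ ((extChartAt I x₀).symm y)
            (gsFrameModel I x₀ ((extChartAt I x₀).symm y) j)
            (gsFrameModel I x₀ ((extChartAt I x₀).symm y) j)))⁻¹ •
          gsFrameModel I x₀ ((extChartAt I x₀).symm y) j :=
    fun y hy ↦ onFrameModel_eq I (hsrc y hy) j
  have hpos : ∀ y ∈ (extChartAt I x₀).target, 0 < trivMetric I x₀ ((extChartAt I x₀).symm y)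
      (gsFrameModel I x₀ ((extChartAt I x₀).symm y) j)
      (gsFrameModel I x₀ ((extChartAt I x₀).symm y) j) := fun y hy ↦
    trivMetric_gsFrameModel_self_pos I (hsrc y hy) j
  have hsm : ContDiffOn ℝ ∞ (fun y ↦
        (√(trivMetric I x₀ ((extChartAt I x₀).symm y)
            (gsFrameModel I x₀ ((extChartAt I x₀).symm y) j)
            (gsFrameModel I x₀ ((extChartAt I x₀).symm y) j)))⁻¹ •
          gsFrameModel I x₀ ((extChartAt I x₀).symm y) j) (extChartAt I x₀).target :=
    ((((hG.clm_apply hgs).clm_apply hgs).sqrt fun y hy ↦ (hpos y hy).ne').inv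
      fun y hy ↦ (Real.sqrt_pos.2 (hpos y hy)).ne').smul hgs
  exact hsm.congr key

end Frame

/-! ### The Hodge star in a chart as a smooth operator-valued function on the target -/

section HodgeStar

variable {E : Type*} [NormedAddCommGroup E] [NormedSpace ℝ E] {n : ℕ} [Fact (finrank ℝ E = n)]
  {H : Type*} [TopologicalSpace H] {I : ModelWithCorners ℝ E H}
  {M : Type*} [TopologicalSpace M] [ChartedSpace H M] [FiniteDimensional ℝ E]
  [RiemannianBundle (fun x : M ↦ TangentSpace I x)] {k m : ℕ}
  (o : (x : M) → Orientation ℝ (TangentSpace I x) (Fin n)) [IsManifold I ∞ M]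

/-- **The chart formula for `⋆` is `C^∞` on the whole chart target**, for any `C^∞` family `A` of
`k`-forms on the target in place of `α̂` (`contDiffWithinAt_hodgeStarChart` globalized with
`contDiffOn_onFrameModel`). [folklore] -/
theorem contDiffOn_hodgeStarChart
    [IsContMDiffRiemannianBundle I ∞ E (fun x : M ↦ TangentSpace I x)] (h : k + m = n)
    {A : E → E [⋀^Fin k]→L[ℝ] ℝ} {x₀ : M} (hA : ContDiffOn ℝ ∞ A (extChartAt I x₀).target)
    (hV : ContDiffOn ℝ ∞ ((riemannianVolumeForm o).inChart x₀) (extChartAt I x₀).target) :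
    ContDiffOn ℝ ∞ (fun y ↦
      ∑ s : Set.powersetCard (Fin n) k,
        (A y (fun i ↦ onFrameModel I x₀ ((extChartAt I x₀).symm y)
            (Set.powersetCard.ofFinEmbEquiv.symm s i))) •
          (((riemannianVolumeForm o).inChart x₀ y).domDomCongr
              (finCongr (show n = m + k by omega))).interiorProductMulti k
            (fun i ↦ onFrameModel I x₀ ((extChartAt I x₀).symm y)
              (Set.powersetCard.ofFinEmbEquiv.symm s i))) (extChartAt I x₀).target := by
  have hc : ∀ j : Fin n, ContDiffOn ℝ ∞ (fun y ↦ onFrameModel I x₀ ((extChartAt I x₀).symm y) j)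
      (extChartAt I x₀).target := contDiffOn_onFrameModel I x₀
  intro y hy
  refine ContDiffWithinAt.sum fun s _ ↦ ?_
  exact (ContDiffWithinAt.continuousAlternatingMap_apply (hA y hy) (fun i ↦ hc _ y hy)).smul
    (ContDiffWithinAt.interiorProductMulti
      (ContDiffWithinAt.continuousAlternatingMap_domDomCongr _ (hV y hy)) (fun i ↦ hc _ y hy))

/-- **The Hodge star in the chart at `x₀` as an operator**: the linear map
`a ↦ ∑_{|s| = k} a(e_s(y)) · ι_{e_s(y)} vol̂(y)` on the model `k`-forms, for `y` in the chart target
(`e = onFrameModel`, the orthonormal frame read in the chart). By `MForm.inChart_hodgeStar_eq`,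
`(⋆α)̂(y) = hodgeStarChartOp y (α̂(y))` (`MForm.inChart_hodgeStar_eq_op`). Warner (1983), 4.10 (6).
[cite: WarnerGTM94, 4.10 (6), p. 150] -/
def hodgeStarChartOp (h : k + m = n) (x₀ : M) (y : E) :
    (E [⋀^Fin k]→L[ℝ] ℝ) →L[ℝ] (E [⋀^Fin m]→L[ℝ] ℝ) :=
  ∑ s : Set.powersetCard (Fin n) k,
    (ContinuousAlternatingMap.apply ℝ E ℝ (fun i ↦ onFrameModel I x₀ ((extChartAt I x₀).symm y)
        (Set.powersetCard.ofFinEmbEquiv.symm s i))).smulRight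
      ((((riemannianVolumeForm o).inChart x₀ y).domDomCongr
          (finCongr (show n = m + k by omega))).interiorProductMulti k
        (fun i ↦ onFrameModel I x₀ ((extChartAt I x₀).symm y)
          (Set.powersetCard.ofFinEmbEquiv.symm s i)))

/-- Unfolding of `hodgeStarChartOp`. [folklore] -/
theorem hodgeStarChartOp_apply (h : k + m = n) (x₀ : M) (y : E) (a : E [⋀^Fin k]→L[ℝ] ℝ) :
    hodgeStarChartOp (I := I) o h x₀ y a = ∑ s : Set.powersetCard (Fin n) k,
      (a (fun i ↦ onFrameModel I x₀ ((extChartAt I x₀).symm y)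
          (Set.powersetCard.ofFinEmbEquiv.symm s i))) •
        (((riemannianVolumeForm o).inChart x₀ y).domDomCongr
            (finCongr (show n = m + k by omega))).interiorProductMulti k
          (fun i ↦ onFrameModel I x₀ ((extChartAt I x₀).symm y)
            (Set.powersetCard.ofFinEmbEquiv.symm s i)) := by
  simp [hodgeStarChartOp]

/-- **`(⋆α)̂(y) = hodgeStarChartOp y (α̂(y))` on the chart target.** [cite: WarnerGTM94, 4.10 (6), p. 150] -/
theorem MForm.inChart_hodgeStar_eq_op (h : k + m = n) (α : MForm I M ℝ k) {x₀ : M} {y : E}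
    (hy : y ∈ (extChartAt I x₀).target) :
    (MForm.hodgeStar o h α).inChart x₀ y = hodgeStarChartOp (I := I) o h x₀ y (α.inChart x₀ y) := by
  rw [hodgeStarChartOp_apply, MForm.inChart_hodgeStar_eq o h α hy]

/-- **The Hodge star in the chart is a `C^∞` operator-valued function on the target** (for a
`C^∞` metric and an orientation family with `C^∞` volume form): tested on each model form `a`
(`contDiffOn_clm_apply`, finite-dimensionality of the model forms) it is the smooth chart
formula. [cite: WarnerGTM94, 4.10 (6), p. 150] -/
theorem contDiffOn_hodgeStarChartOp
    [IsContMDiffRiemannianBundle I ∞ E (fun x : M ↦ TangentSpace I x)] (h : k + m = n) (x₀ : M)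
    (hV : ContDiffOn ℝ ∞ ((riemannianVolumeForm o).inChart x₀) (extChartAt I x₀).target) :
    ContDiffOn ℝ ∞ (hodgeStarChartOp (I := I) o h x₀) (extChartAt I x₀).target := by
  haveI : FiniteDimensional ℝ (E [⋀^Fin k]→L[ℝ] ℝ) := by
    let L : (E [⋀^Fin k]→L[ℝ] ℝ) →ₗ[ℝ] MultilinearMap ℝ (fun _ : Fin k ↦ E) ℝ :=
      { toFun := fun f ↦ f.toContinuousMultilinearMap.toMultilinearMap
        map_add' := fun _ _ ↦ rfl
        map_smul' := fun _ _ ↦ rfl }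
    have hL : Function.Injective L := fun f g hfg ↦
      ContinuousAlternatingMap.ext fun v ↦ (DFunLike.congr_fun hfg v : _)
    exact Module.Finite.of_injective L hL
  refine contDiffOn_clm_apply.2 fun a ↦ ?_
  have := contDiffOn_hodgeStarChart o h (A := fun _ ↦ a) (x₀ := x₀) contDiffOn_const hV
  refine this.congr fun y _ ↦ ?_
  exact hodgeStarChartOp_apply o h x₀ y a

end HodgeStar

/-! ### The pointwise inner product of forms in a chart -/

section Inner

variable {E : Type*} [NormedAddCommGroup E] [NormedSpace ℝ E] {n : ℕ} [Fact (finrank ℝ E = n)]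
  {H : Type*} [TopologicalSpace H] {I : ModelWithCorners ℝ E H}
  {M : Type*} [TopologicalSpace M] [ChartedSpace H M] [FiniteDimensional ℝ E]
  [RiemannianBundle (fun x : M ↦ TangentSpace I x)] {k : ℕ} [IsManifold I ∞ M]

variable (n) in
/-- The **weight of the pointwise inner product of `k`-forms in the chart at `x₀`**: the bilinear
form `(a, b) ↦ ∑_{|s| = k} a(e_s(y)) b(e_s(y))` on the model `k`-forms, `e = onFrameModel` the
orthonormal frame read in the chart (so that `⟪α x, β x⟫ = innerChart y (α̂ y) (β̂ y)`,
`MForm.inner_eq_innerChart`). Warner (1983), Ch. 2 Ex. 13 (1) / 6.1 (5). [cite: WarnerGTM94, 6.1 (5), p. 220] -/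
def innerChart (k : ℕ) (x₀ : M) (y : E) (a b : E [⋀^Fin k]→L[ℝ] ℝ) : ℝ :=
  ∑ s : Set.powersetCard (Fin n) k,
    a (fun i ↦ onFrameModel I x₀ ((extChartAt I x₀).symm y) (Set.powersetCard.ofFinEmbEquiv.symm s i)) *
      b (fun i ↦ onFrameModel I x₀ ((extChartAt I x₀).symm y) (Set.powersetCard.ofFinEmbEquiv.symm s i))

/-- **The pointwise inner product read in a chart**: for `x` in the chart domain of `x₀`,
`⟪α x, β x⟫ = ∑_s α̂(y)(e_s(y)) β̂(y)(e_s(y))` with `y = φ x` (basis independence of the inner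
product on forms, `alternatingFormInner_eq_sum_holds`, for the Gram–Schmidt orthonormal basis
`onBasis I x₀ x`, whose vectors are the push-forwards of the frame `onFrameModel` by the
derivative of the inverse chart). [cite: WarnerGTM94, 6.1 (5), p. 220] -/
theorem MForm.inner_eq_innerChart (α β : MForm I M ℝ k) {x₀ : M} {y : E}
    (hy : y ∈ (extChartAt I x₀).target) :
    MForm.inner n α β ((extChartAt I x₀).symm y) = innerChart (I := I) n k x₀ y (α.inChart x₀ y) (β.inChart x₀ y) := by
  have hx : (extChartAt I x₀).symm y ∈ (chartAt H x₀).source := by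
    rw [← extChartAt_source I]
    exact (extChartAt I x₀).map_target hy
  have hD : mfderivWithin 𝓘(ℝ, E) I (extChartAt I x₀).symm (range I) y =
      (trivializationAt E (TangentSpace I) x₀).symmL ℝ ((extChartAt I x₀).symm y) := by
    rw [TangentBundle.symmL_trivializationAt hx, (extChartAt I x₀).right_inv hy]
  have hsum := alternatingFormInner_eq_sum_holds (V := TangentSpace I ((extChartAt I x₀).symm y)) (n := n)
    (onBasis I x₀ ((extChartAt I x₀).symm y)) k (α ((extChartAt I x₀).symm y)) (β ((extChartAt I x₀).symm y))
  rw [MForm.inner, hsum, innerChart]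
  refine Finset.sum_congr rfl fun s _ ↦ ?_
  have hB : (onBasis I x₀ ((extChartAt I x₀).symm y)).multiIndex s = fun i ↦
      (trivializationAt E (TangentSpace I) x₀).symmL ℝ ((extChartAt I x₀).symm y)
        (onFrameModel I x₀ ((extChartAt I x₀).symm y) (Set.powersetCard.ofFinEmbEquiv.symm s i)) := by
    funext i
    rw [OrthonormalBasis.multiIndex_apply, onBasis_apply I hx]
  rw [hB, MForm.inChart_apply, MForm.inChart_apply, hD]
  rfl

/-- The weight is `C^∞` on the chart target as a function of `y`, for `C^∞` families of model
forms in both slots (a `C^∞` metric). [folklore] -/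
theorem contDiffOn_innerChart [IsContMDiffRiemannianBundle I ∞ E (fun x : M ↦ TangentSpace I x)]
    {x₀ : M} {A B : E → E [⋀^Fin k]→L[ℝ] ℝ} (hA : ContDiffOn ℝ ∞ A (extChartAt I x₀).target)
    (hB : ContDiffOn ℝ ∞ B (extChartAt I x₀).target) :
    ContDiffOn ℝ ∞ (fun y ↦ innerChart (I := I) n k x₀ y (A y) (B y)) (extChartAt I x₀).target := by
  have hc : ∀ j : Fin n, ContDiffOn ℝ ∞ (fun y ↦ onFrameModel I x₀ ((extChartAt I x₀).symm y) j)
      (extChartAt I x₀).target := contDiffOn_onFrameModel I x₀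
  intro y hy
  refine ContDiffWithinAt.sum fun s _ ↦ ?_
  exact (ContDiffWithinAt.continuousAlternatingMap_apply (hA y hy) (fun i ↦ hc _ y hy)).mul
    (ContDiffWithinAt.continuousAlternatingMap_apply (hB y hy) (fun i ↦ hc _ y hy))

/-- The weight is positive semidefinite: `0 ≤ innerChart y a a` (a sum of squares). [folklore] -/
theorem innerChart_self_nonneg (x₀ : M) (y : E) (a : E [⋀^Fin k]→L[ℝ] ℝ) :
    0 ≤ innerChart (I := I) n k x₀ y a a :=
  Finset.sum_nonneg fun _ _ ↦ mul_self_nonneg _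

end Inner

end Literature.Geometry.Kaehler
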